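import Summits.QuantumFields.YangMills.Theorems.LuscherReductionOneSiteLevelsKacInnerData
import Summits.QuantumFields.YangMills.Theorems.LuscherReductionOneSiteLevelsAbsLowerPrep

/-!
# INNER, layers I + II assembled: `FlatKacFormBound k ⟹ OneSiteAbsUpperInner k` (the registered stub `stub_innerOfFlatKac`)

Support module of crux `OneSiteLevels` (route `LuscherReduction`, item stmt-QuantumFields-20007; STUB-PLAN
`Cruxes/OneSiteLevels/STUB-PLAN-stub_absUpperInnerAL1.md` §2.2 item II.5, owner ruling INNER-RULING-g16: v12 registers
`stub_innerOfFlatKac : ∀ k, FlatKacFormBound k → OneSiteAbsUpperInner k`), fleet seat ym-luscher-20007-p2 (LATTICE lane).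
Everything here is proved, AL1-free.

For `B ≥ B₁(k) = max 2 (2/t₁³)`, `t₁ = min t₀ (1/600)` (`t₀, C, f_i` from `FlatKacFormBound k` at `κ = 7`), write `t = λ_b(B)`,
`μ = t/2`, `R₀ = 7/√t`.  With the flat data of `…KacInnerData` (`gFlat`, `phiFlat`, `l2_phiPullback`) and the five analytic inputs
— mass `∫ g² ≤ 8ρ₀ ∫ gFlat²` (`…KacFlatten`), magnetic minorant `∫ B·S·g² ≥ 8ρ₀ t (1 − 98t) ∫ V gFlat²` (`…KacFlatten`), kinetic
minorant `latticeJump B g ≥ 8ρ₀ t (1 − 294t)² flatJumpBall` (`…KacFlattenJump`), Gaussian tail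
`flatJump ≤ flatJumpBall + t⁻¹√2⁹e^{−49/(4t²)} ∫ gFlat²` (`…KacTail`), and the flat Kac bound `(E_k − Ct)∫ gFlat² ≤ kacForm t gFlat`
(the hypothesis) — the real-arithmetic skeleton `assembly_ineq` gives
`(E_k t − C₁ t²) ∫ g² ≤ latticeJump B g + ∫ B·S·g²`, `C₁ = 600E_k + 601|C| + 2`: **`jumpEnergyLower_of_flatKac`**
(`FlatKacFormBound k → JumpEnergyLowerInner k`), and layer I (`inner_of_jumpEnergyLower`, `…KacJump`) yields the skeleton's
`OneSiteAbsUpperInner k` VERBATIM: **`innerOfFlatKac`** — the v12 stub `stub_innerOfFlatKac k` is `fun h => innerOfFlatKac k h`.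

## WHAT THIS IS NOT
Not the INNER stub `stub_absUpperInnerAL1` itself: that still needs layer III `(∀ k, AL1 k) → ∀ k, FlatKacFormBound k` (FLAT lane).
Femto rung R2b1 vocabulary; AL1-conditional closure lives in the skeleton; NOT an infinite-volume ∕ Clay mass-gap statement.
-/

set_option autoImplicit false

noncomputable section

open MeasureTheory Filter Topology Real
open scoped ENNReal
open Literature.MathematicalPhysics.QuantumFieldTheory
open Literature.MathematicalPhysics.QuantumLattice
open Literature.Analysis.OperatorTheory.YMMatrixModel

namespace Summit.QuantumFields.YangMills.Theorems.FemtoTransferGap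

/-! ### Assembly: `FlatKacFormBound k ⟹ JumpEnergyLowerInner k ⟹ OneSiteAbsUpperInner k` -/

/-- The elementary constant bookkeeping of the assembly: for `0 < t ≤ 1/600` and any `E`, `C`,
`E t − (600E + 601|C| + 2) t² ≤ t(1 − 600t)(E − Ct) − (1 − 600t)·√2⁹·e^{−49/(4t²)}` (any real `E`). [folklore] -/
theorem assembly_constants {t E C : ℝ} (ht : 0 < t) (ht1 : t ≤ 1 / 600) :
    E * t - (600 * E + 601 * |C| + 2) * t ^ 2 ≤
      t * (1 - 600 * t) * (E - C * t) - (1 - 600 * t) * (Real.sqrt 2 ^ 9 * Real.exp (-(49 / (4 * t ^ 2)))) := by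
  have h600 : 0 ≤ 1 - 600 * t := by linarith
  have hexp : Real.exp (-(49 / (4 * t ^ 2))) ≤ 4 * t ^ 2 / 49 := by
    have hx : 0 < 49 / (4 * t ^ 2) := by positivity
    have h1 : 49 / (4 * t ^ 2) ≤ Real.exp (49 / (4 * t ^ 2)) := by linarith [Real.add_one_le_exp (49 / (4 * t ^ 2))]
    rw [Real.exp_neg]
    calc (Real.exp (49 / (4 * t ^ 2)))⁻¹ ≤ (49 / (4 * t ^ 2))⁻¹ := inv_anti₀ hx h1
      _ = 4 * t ^ 2 / 49 := by rw [inv_div]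
  have hs := sqrt_two_pow_nine_le
  have hs0 : 0 ≤ Real.sqrt 2 ^ 9 := by positivity
  have htail : (1 - 600 * t) * (Real.sqrt 2 ^ 9 * Real.exp (-(49 / (4 * t ^ 2)))) ≤ 2 * t ^ 2 := by
    calc (1 - 600 * t) * (Real.sqrt 2 ^ 9 * Real.exp (-(49 / (4 * t ^ 2))))
        ≤ 1 * (23 * (4 * t ^ 2 / 49)) := by
          refine mul_le_mul (by linarith) (mul_le_mul hs hexp (by positivity) (by norm_num)) (by positivity) zero_le_one
      _ ≤ 2 * t ^ 2 := by nlinarith [sq_nonneg t]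
  have hC : C * t ≤ |C| * t := mul_le_mul_of_nonneg_right (le_abs_self C) ht.le
  have hC' : -(C * t) ≤ |C| * t := by have := neg_abs_le C; nlinarith
  have ht2 : t ^ 3 ≤ t ^ 2 := by nlinarith [sq_nonneg t]
  -- `t(1−600t)(E − Ct) ≥ Et − (600E + 601|C|)t²`
  have hmain : E * t - (600 * E + 601 * |C|) * t ^ 2 ≤ t * (1 - 600 * t) * (E - C * t) := by
    have e : t * (1 - 600 * t) * (E - C * t) = E * t - 600 * E * t ^ 2 - C * t ^ 2 + 600 * C * t ^ 3 := by ring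
    rw [e]
    have h1 : C * t ^ 2 ≤ |C| * t ^ 2 := mul_le_mul_of_nonneg_right (le_abs_self C) (sq_nonneg t)
    have h2 : -(600 * C * t ^ 3) ≤ 600 * |C| * t ^ 2 := by
      have h3 : -(C * t ^ 3) ≤ |C| * t ^ 3 := by
        have := neg_abs_le C; nlinarith [pow_pos ht 3]
      have h4 : |C| * t ^ 3 ≤ |C| * t ^ 2 := mul_le_mul_of_nonneg_left ht2 (abs_nonneg C)
      linarith
    nlinarith
  nlinarith

/-- **The real-arithmetic skeleton of the assembly.**  From the five analytic inputs (mass `M0 ≤ 8ρ₀ m`, kinetic minorant `hJ`,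
magnetic minorant `hV`, Gaussian tail `hT`, flat Kac bound `hK`) at `0 < t ≤ 1/600`:
`(E t − C₁ t²) M0 ≤ J + Vl` with `C₁ = 600E + 601|C| + 2`. [folklore] -/
theorem assembly_ineq {t E C ρ₀ M0 J Vl m FJB FJ Vf : ℝ} (ht : 0 < t) (ht1 : t ≤ 1 / 600) (hρ₀ : 0 < ρ₀)
    (hM0 : 0 ≤ M0) (hM : M0 ≤ 8 * ρ₀ * m) (hm : 0 ≤ m) (hFJB : 0 ≤ FJB) (hVf : 0 ≤ Vf) (hJ0 : 0 ≤ J) (hVl0 : 0 ≤ Vl)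
    (hJ : 8 * ρ₀ * t * (1 - 294 * t) ^ 2 * FJB ≤ J) (hV : 8 * ρ₀ * t * (1 - 98 * t) * Vf ≤ Vl)
    (hT : FJ ≤ FJB + 1 / t * (Real.sqrt 2 ^ 9 * Real.exp (-(49 / (4 * t ^ 2)))) * m) (hK : (E - C * t) * m ≤ FJ + Vf) :
    (E * t - (600 * E + 601 * |C| + 2) * t ^ 2) * M0 ≤ J + Vl := by
  set a : ℝ := 1 - 600 * t with ha
  set s : ℝ := Real.sqrt 2 ^ 9 * Real.exp (-(49 / (4 * t ^ 2))) with hs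
  have ha0 : 0 ≤ a := by rw [ha]; linarith
  have hs0 : 0 ≤ s := by positivity
  have hρt : 0 ≤ 8 * ρ₀ * t := by positivity
  -- step 1: both lattice minorants dominate `8ρ₀ t a (FJB + Vf)`
  have h1a : 8 * ρ₀ * t * a * FJB ≤ J := by
    refine le_trans ?_ hJ
    have : a ≤ (1 - 294 * t) ^ 2 := by rw [ha]; nlinarith [sq_nonneg t]
    exact mul_le_mul_of_nonneg_right (mul_le_mul_of_nonneg_left this hρt) hFJB
  have h1b : 8 * ρ₀ * t * a * Vf ≤ Vl := by
    refine le_trans ?_ hV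
    have : a ≤ 1 - 98 * t := by rw [ha]; linarith
    exact mul_le_mul_of_nonneg_right (mul_le_mul_of_nonneg_left this hρt) hVf
  -- step 2: the flat side
  have h2 : (E - C * t) * m - 1 / t * s * m ≤ FJB + Vf := by linarith
  -- step 3: combine
  have h3 : 8 * ρ₀ * t * a * ((E - C * t) * m - 1 / t * s * m) ≤ J + Vl := by
    have := mul_le_mul_of_nonneg_left h2 (mul_nonneg hρt ha0)
    linarith
  have e3 : 8 * ρ₀ * t * a * ((E - C * t) * m - 1 / t * s * m) = 8 * ρ₀ * m * (t * a * (E - C * t) - a * s) := by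
    field_simp
  rw [e3] at h3
  -- step 4: constants
  have h4 : E * t - (600 * E + 601 * |C| + 2) * t ^ 2 ≤ t * a * (E - C * t) - a * s := by
    rw [ha, hs]; exact assembly_constants ht ht1
  have h5 : 8 * ρ₀ * m * (E * t - (600 * E + 601 * |C| + 2) * t ^ 2) ≤ J + Vl :=
    le_trans (mul_le_mul_of_nonneg_left h4 (by positivity)) h3
  -- step 5: the mass
  rcases le_or_gt (E * t - (600 * E + 601 * |C| + 2) * t ^ 2) 0 with hneg | hpos
  · have : (E * t - (600 * E + 601 * |C| + 2) * t ^ 2) * M0 ≤ 0 := mul_nonpos_of_nonpos_of_nonneg hneg hM0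
    linarith
  · calc (E * t - (600 * E + 601 * |C| + 2) * t ^ 2) * M0
        ≤ (E * t - (600 * E + 601 * |C| + 2) * t ^ 2) * (8 * ρ₀ * m) := mul_le_mul_of_nonneg_left hM hpos.le
      _ = 8 * ρ₀ * m * (E * t - (600 * E + 601 * |C| + 2) * t ^ 2) := by ring
      _ ≤ J + Vl := h5

/-- **Layer II — `FlatKacFormBound k ⟹ JumpEnergyLowerInner k`** (monotone gnomonic flattening; STUB-PLAN II.5).  With `κ = 7`
in `FlatKacFormBound k` (constants `C, t₀`, flat constraints `f_i`): for `B ≥ B₁ = max 2 (2/t₁³)`, `t₁ = min t₀ (1/600)`, the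
lattice constraints are `φ_i = phiFlat B f_i ∘ gnCoord (λ_b/2)` and `C₁ = 600 E_k + 601|C| + 2`.
[cite: Luscher1983, §3] [cite: SimonB1983DiscreteSpectrum, §3] -/
theorem jumpEnergyLower_of_flatKac (k : ℕ) (hFlat : FlatKacFormBound k) : JumpEnergyLowerInner k := by
  obtain ⟨C, t₀, ht₀, fs, hfc, hfb, hfi, _hfint, hbound⟩ := hFlat 7 (by norm_num)
  set t₁ : ℝ := min t₀ (1 / 600) with ht₁
  have ht₁pos : 0 < t₁ := lt_min ht₀ (by norm_num)
  refine ⟨600 * physLevel (k + 1) + 601 * |C| + 2, max 2 (2 / t₁ ^ 3), le_max_left _ _, fun B hB => ?_⟩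
  -- parameters at coupling `B`: `t = λ_b`, `μ = t/2`, `R₀ = 7/√t`
  have hB2 : 2 ≤ B := (le_max_left _ _).trans hB
  have hBpos : 0 < B := by linarith
  have ht : 0 < bareLambda B := bareLambda_pos' hBpos
  have ht1' : bareLambda B ≤ t₁ := bareLambda_le_of_le ht₁pos ((le_max_right _ _).trans hB)
  have htt₀ : bareLambda B ≤ t₀ := ht1'.trans (min_le_left _ _)
  have ht600 : bareLambda B ≤ 1 / 600 := ht1'.trans (min_le_right _ _)
  have ht4 : bareLambda B ≤ 1 / 4 := by linarith
  have hBt : B = 2 / bareLambda B ^ 3 := by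
    have h := bareLambda_cube hBpos
    field_simp
    linarith
  have hμ : 0 < bareLambda B / 2 := by positivity
  have hsq : Real.sqrt (bareLambda B) ^ 2 = bareLambda B := Real.sq_sqrt ht.le
  have hsqpos : 0 < Real.sqrt (bareLambda B) := Real.sqrt_pos.2 ht
  have hR₀ : (0 : ℝ) ≤ 7 / Real.sqrt (bareLambda B) := by positivity
  have hμR₀ : (bareLambda B / 2) ^ 2 * (7 / Real.sqrt (bareLambda B)) ^ 2 = 49 / 4 * bareLambda B := by
    rw [div_pow, div_pow, hsq]; field_simp; ring
  have hρ₀ : 0 < (bareLambda B / 2) ^ 9 * ((2 * π ^ 2)⁻¹) ^ 3 := by positivity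
  have hwinφ : 6 * ((bareLambda B / 2) ^ 2 * (7 / Real.sqrt (bareLambda B)) ^ 2) ≤ 1 / 2 := by rw [hμR₀]; linarith
  have hwin6 : 6 * ((bareLambda B / 2) ^ 2 * (7 / Real.sqrt (bareLambda B)) ^ 2) ≤ 1 := by linarith
  have h4R : (bareLambda B / 2) ^ 2 * (2 * (7 / Real.sqrt (bareLambda B))) ^ 2 =
      4 * ((bareLambda B / 2) ^ 2 * (7 / Real.sqrt (bareLambda B)) ^ 2) := by ring
  have hR6 : 6 * ((bareLambda B / 2) ^ 2 * (2 * (7 / Real.sqrt (bareLambda B))) ^ 2) ≤ 1 := by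
    rw [h4R, hμR₀]; linarith
  -- the constraints
  refine ⟨fun i U => phiFlat B (fs i) (gnCoord (bareLambda B / 2) U), fun i => ?_, fun ψ hψ horth => ?_⟩
  · obtain ⟨Mi, hMi⟩ := hfb i
    exact isPhys_gnPullback (measurable_phiFlat B (hfc i).measurable) ⟨_, abs_phiFlat_le hBpos ht4 hwinφ hMi⟩
      (isGaugeInv_phiFlat B (hfi i)) (bareLambda B / 2)
  -- the test function and its flat representative
  obtain ⟨Cψ, hCψ⟩ := hψ.bounded
  have hfphys : IsPhys (fun U => Real.cos (onePhase (onePhaseScale B) U) * ψ U) := isPhys_cos_onePhase_mul _ hψ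
  have hfb' : ∀ U : Cfg, |Real.cos (onePhase (onePhaseScale B) U) * ψ U| ≤ Cψ := fun U => by
    rw [abs_mul]
    exact (mul_le_of_le_one_left (abs_nonneg _) (Real.abs_cos_le_one _)).trans (hCψ U)
  set g : Cfg → ℝ := magWeight B (fun U => Real.cos (onePhase (onePhaseScale B) U) * ψ U) with hg
  have hgm : Measurable g := measurable_magWeight B hfphys.measurable
  have hgb : ∀ U, |g U| ≤ Cψ := magWeight_bounded hBpos.le hfb'
  set G : ZM → ℝ := gFlat B ψ with hG
  have hrep : ∀ σ y, g (gnChart (bareLambda B / 2) σ y) = G y := fun σ y => magWeight_cos_gnChart hψ B σ y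
  have hGm : Measurable G := measurable_gFlat B hψ.measurable
  have hGb : ∀ y, |G y| ≤ Cψ := abs_gFlat_le hBpos.le hCψ
  have hGinv : IsGaugeInv G := isGaugeInv_gFlat B hψ
  have hGsupp : ∀ y, G y ≠ 0 → ‖y‖ ≤ 7 / Real.sqrt (bareLambda B) := fun y hy => norm_le_of_gFlat_ne_zero hBpos ht4 hy
  have hG2i : Integrable fun y => G y ^ 2 := integrable_sq_of_bounded_of_support hGm hGb hGsupp
  have hVi : Integrable fun y => luscherPotential y * G y ^ 2 := integrable_potential_mul_sq hGm hGb hGsupp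
  -- orthogonality transfers
  have horthG : ∀ i, ∫ y, G y * fs i y = 0 := by
    intro i
    obtain ⟨Mi, hMi⟩ := hfb i
    have h8 := l2_phiPullback hBpos hψ (hfc i).measurable (abs_phiFlat_le hBpos ht4 hwinφ hMi)
    have h0 := horth i
    rw [h8] at h0
    linarith
  -- the five analytic inputs
  have hM : ∫ U, g U ^ 2 ∂cfgMeasure ≤ 8 * ((bareLambda B / 2) ^ 9 * ((2 * π ^ 2)⁻¹) ^ 3) * ∫ y, G y ^ 2 :=
    integral_sq_le_of_chartRep hμ hgm ⟨Cψ, hgb⟩ hrep hG2i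
  have hM0 : 0 ≤ ∫ U, g U ^ 2 ∂cfgMeasure := integral_nonneg fun U => sq_nonneg _
  have hV := integral_action_mul_sq_ge hBpos.le hμ hgm ⟨Cψ, hgb⟩ hrep hGsupp hwin6 hVi
  have hJ := latticeJump_ge_flatJumpBall ht hgm hgb hGm hGb hrep hR6
  rw [← hBt] at hJ
  have hT := flatJump_le_flatJumpBall_add_exp ht hGm hGb hR₀ hGsupp
  have hK := hbound (bareLambda B) ht htt₀ G hGm ⟨Cψ, hGb⟩ hGinv hGsupp horthG
  rw [kacForm] at hK
  -- constants in the inputs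
  have e8 : 8 * B * (bareLambda B / 2) ^ 4 = bareLambda B := by
    linear_combination (bareLambda B / 2) * bareLambda_cube hBpos
  have e98 : 1 - 8 * ((bareLambda B / 2) ^ 2 * (7 / Real.sqrt (bareLambda B)) ^ 2) = 1 - 98 * bareLambda B := by
    rw [hμR₀]; ring
  have e294 : 1 - 6 * ((bareLambda B / 2) ^ 2 * (2 * (7 / Real.sqrt (bareLambda B))) ^ 2) = 1 - 294 * bareLambda B := by
    rw [h4R, hμR₀]; ring
  have e49 : (7 / Real.sqrt (bareLambda B)) ^ 2 / (4 * bareLambda B) = 49 / (4 * bareLambda B ^ 2) := by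
    rw [div_pow, hsq]; field_simp; ring
  rw [e8, e98] at hV
  rw [e294] at hJ
  rw [e49] at hT
  exact assembly_ineq ht ht600 hρ₀ hM0 hM (integral_nonneg fun y => sq_nonneg _)
    (flatJumpBall_nonneg ht _ _) (integral_nonneg fun y => mul_nonneg (luscherPotential_nonneg y) (sq_nonneg _))
    (latticeJump_nonneg hBpos.le g)
    (integral_nonneg fun U => mul_nonneg (mul_nonneg hBpos.le (wilsonAction_su2_nonneg U)) (sq_nonneg _)) hJ hV hT hK

/-- **`FlatKacFormBound k ⟹ OneSiteAbsUpperInner k`** — the skeleton's INNER statement verbatim from the flat Kac-form bound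
(layers I + II of the STUB-PLAN; discharges the registered stub `stub_innerOfFlatKac k` of v12 as `fun k h => innerOfFlatKac k h`).
[cite: Luscher1983, §3] [cite: SimonB1983DiscreteSpectrum, §3] [cite: LiebYau1988, (2.9)–(2.11)] -/
theorem innerOfFlatKac (k : ℕ) (hFlat : FlatKacFormBound k) :
    ∃ C₁ B₁ : ℝ, 2 ≤ B₁ ∧ ∀ B, B₁ ≤ B → ∃ φs : Fin k → Cfg → ℝ, (∀ i, IsPhys (φs i)) ∧
      ∀ ψ : Cfg → ℝ, IsPhys ψ → (∀ i, l2 ψ (φs i) = 0) →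
      qform su2Rep B (fun U => Real.cos (onePhase (onePhaseScale B) U) * ψ U) (fun U => Real.cos (onePhase (onePhaseScale B) U) * ψ U)
        ≤ linkCE B * Real.exp (-(physLevel (k + 1) * bareLambda B) + C₁ * bareLambda B ^ 2)
          * l2 (fun U => Real.cos (onePhase (onePhaseScale B) U) * ψ U) (fun U => Real.cos (onePhase (onePhaseScale B) U) * ψ U) :=
  inner_of_jumpEnergyLower k (jumpEnergyLower_of_flatKac k hFlat)


/-! ### Appendix: the `κ = 7` instance suffices (insurance for the flat lane) -/

/-- **Layer II from the `κ = 7` instance alone.**  The proof of `jumpEnergyLower_of_flatKac` consumes `FlatKacFormBound k` only at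
`κ = 7`; this variant takes exactly that instance (the body of `FlatKacFormBound k` at `κ = 7`) as its hypothesis, so a flat lane
that proves the Kac-form bound for one fixed support radius already closes INNER. [cite: Luscher1983, §3] [cite: SimonB1983DiscreteSpectrum, §3] -/
theorem jumpEnergyLower_of_flatKacAt (k : ℕ)
    (h7 : ∃ C t₀ : ℝ, 0 < t₀ ∧ ∃ fs : Fin k → ZM → ℝ,
      (∀ i, Continuous (fs i)) ∧ (∀ i, ∃ M : ℝ, ∀ x, |fs i x| ≤ M) ∧ (∀ i, IsGaugeInv (fs i)) ∧ (∀ i, Integrable (fs i)) ∧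
      ∀ t : ℝ, 0 < t → t ≤ t₀ → ∀ g : ZM → ℝ, Measurable g → (∃ M : ℝ, ∀ x, |g x| ≤ M) → IsGaugeInv g →
        (∀ x, g x ≠ 0 → ‖x‖ ≤ 7 / Real.sqrt t) → (∀ i, ∫ x, g x * fs i x = 0) →
        (physLevel (k + 1) - C * t) * ∫ x, g x ^ 2 ≤ kacForm t g) :
    JumpEnergyLowerInner k := by
  obtain ⟨C, t₀, ht₀, fs, hfc, hfb, hfi, _hfint, hbound⟩ := h7
  set t₁ : ℝ := min t₀ (1 / 600) with ht₁
  have ht₁pos : 0 < t₁ := lt_min ht₀ (by norm_num)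
  refine ⟨600 * physLevel (k + 1) + 601 * |C| + 2, max 2 (2 / t₁ ^ 3), le_max_left _ _, fun B hB => ?_⟩
  -- parameters at coupling `B`: `t = λ_b`, `μ = t/2`, `R₀ = 7/√t`
  have hB2 : 2 ≤ B := (le_max_left _ _).trans hB
  have hBpos : 0 < B := by linarith
  have ht : 0 < bareLambda B := bareLambda_pos' hBpos
  have ht1' : bareLambda B ≤ t₁ := bareLambda_le_of_le ht₁pos ((le_max_right _ _).trans hB)
  have htt₀ : bareLambda B ≤ t₀ := ht1'.trans (min_le_left _ _)
  have ht600 : bareLambda B ≤ 1 / 600 := ht1'.trans (min_le_right _ _)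
  have ht4 : bareLambda B ≤ 1 / 4 := by linarith
  have hBt : B = 2 / bareLambda B ^ 3 := by
    have h := bareLambda_cube hBpos
    field_simp
    linarith
  have hμ : 0 < bareLambda B / 2 := by positivity
  have hsq : Real.sqrt (bareLambda B) ^ 2 = bareLambda B := Real.sq_sqrt ht.le
  have hsqpos : 0 < Real.sqrt (bareLambda B) := Real.sqrt_pos.2 ht
  have hR₀ : (0 : ℝ) ≤ 7 / Real.sqrt (bareLambda B) := by positivity
  have hμR₀ : (bareLambda B / 2) ^ 2 * (7 / Real.sqrt (bareLambda B)) ^ 2 = 49 / 4 * bareLambda B := by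
    rw [div_pow, div_pow, hsq]; field_simp; ring
  have hρ₀ : 0 < (bareLambda B / 2) ^ 9 * ((2 * π ^ 2)⁻¹) ^ 3 := by positivity
  have hwinφ : 6 * ((bareLambda B / 2) ^ 2 * (7 / Real.sqrt (bareLambda B)) ^ 2) ≤ 1 / 2 := by rw [hμR₀]; linarith
  have hwin6 : 6 * ((bareLambda B / 2) ^ 2 * (7 / Real.sqrt (bareLambda B)) ^ 2) ≤ 1 := by linarith
  have h4R : (bareLambda B / 2) ^ 2 * (2 * (7 / Real.sqrt (bareLambda B))) ^ 2 =
      4 * ((bareLambda B / 2) ^ 2 * (7 / Real.sqrt (bareLambda B)) ^ 2) := by ring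
  have hR6 : 6 * ((bareLambda B / 2) ^ 2 * (2 * (7 / Real.sqrt (bareLambda B))) ^ 2) ≤ 1 := by
    rw [h4R, hμR₀]; linarith
  -- the constraints
  refine ⟨fun i U => phiFlat B (fs i) (gnCoord (bareLambda B / 2) U), fun i => ?_, fun ψ hψ horth => ?_⟩
  · obtain ⟨Mi, hMi⟩ := hfb i
    exact isPhys_gnPullback (measurable_phiFlat B (hfc i).measurable) ⟨_, abs_phiFlat_le hBpos ht4 hwinφ hMi⟩
      (isGaugeInv_phiFlat B (hfi i)) (bareLambda B / 2)
  -- the test function and its flat representative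
  obtain ⟨Cψ, hCψ⟩ := hψ.bounded
  have hfphys : IsPhys (fun U => Real.cos (onePhase (onePhaseScale B) U) * ψ U) := isPhys_cos_onePhase_mul _ hψ
  have hfb' : ∀ U : Cfg, |Real.cos (onePhase (onePhaseScale B) U) * ψ U| ≤ Cψ := fun U => by
    rw [abs_mul]
    exact (mul_le_of_le_one_left (abs_nonneg _) (Real.abs_cos_le_one _)).trans (hCψ U)
  set g : Cfg → ℝ := magWeight B (fun U => Real.cos (onePhase (onePhaseScale B) U) * ψ U) with hg
  have hgm : Measurable g := measurable_magWeight B hfphys.measurable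
  have hgb : ∀ U, |g U| ≤ Cψ := magWeight_bounded hBpos.le hfb'
  set G : ZM → ℝ := gFlat B ψ with hG
  have hrep : ∀ σ y, g (gnChart (bareLambda B / 2) σ y) = G y := fun σ y => magWeight_cos_gnChart hψ B σ y
  have hGm : Measurable G := measurable_gFlat B hψ.measurable
  have hGb : ∀ y, |G y| ≤ Cψ := abs_gFlat_le hBpos.le hCψ
  have hGinv : IsGaugeInv G := isGaugeInv_gFlat B hψ
  have hGsupp : ∀ y, G y ≠ 0 → ‖y‖ ≤ 7 / Real.sqrt (bareLambda B) := fun y hy => norm_le_of_gFlat_ne_zero hBpos ht4 hy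
  have hG2i : Integrable fun y => G y ^ 2 := integrable_sq_of_bounded_of_support hGm hGb hGsupp
  have hVi : Integrable fun y => luscherPotential y * G y ^ 2 := integrable_potential_mul_sq hGm hGb hGsupp
  -- orthogonality transfers
  have horthG : ∀ i, ∫ y, G y * fs i y = 0 := by
    intro i
    obtain ⟨Mi, hMi⟩ := hfb i
    have h8 := l2_phiPullback hBpos hψ (hfc i).measurable (abs_phiFlat_le hBpos ht4 hwinφ hMi)
    have h0 := horth i
    rw [h8] at h0
    linarith
  -- the five analytic inputs
  have hM : ∫ U, g U ^ 2 ∂cfgMeasure ≤ 8 * ((bareLambda B / 2) ^ 9 * ((2 * π ^ 2)⁻¹) ^ 3) * ∫ y, G y ^ 2 :=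
    integral_sq_le_of_chartRep hμ hgm ⟨Cψ, hgb⟩ hrep hG2i
  have hM0 : 0 ≤ ∫ U, g U ^ 2 ∂cfgMeasure := integral_nonneg fun U => sq_nonneg _
  have hV := integral_action_mul_sq_ge hBpos.le hμ hgm ⟨Cψ, hgb⟩ hrep hGsupp hwin6 hVi
  have hJ := latticeJump_ge_flatJumpBall ht hgm hgb hGm hGb hrep hR6
  rw [← hBt] at hJ
  have hT := flatJump_le_flatJumpBall_add_exp ht hGm hGb hR₀ hGsupp
  have hK := hbound (bareLambda B) ht htt₀ G hGm ⟨Cψ, hGb⟩ hGinv hGsupp horthG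
  rw [kacForm] at hK
  -- constants in the inputs
  have e8 : 8 * B * (bareLambda B / 2) ^ 4 = bareLambda B := by
    linear_combination (bareLambda B / 2) * bareLambda_cube hBpos
  have e98 : 1 - 8 * ((bareLambda B / 2) ^ 2 * (7 / Real.sqrt (bareLambda B)) ^ 2) = 1 - 98 * bareLambda B := by
    rw [hμR₀]; ring
  have e294 : 1 - 6 * ((bareLambda B / 2) ^ 2 * (2 * (7 / Real.sqrt (bareLambda B))) ^ 2) = 1 - 294 * bareLambda B := by
    rw [h4R, hμR₀]; ring
  have e49 : (7 / Real.sqrt (bareLambda B)) ^ 2 / (4 * bareLambda B) = 49 / (4 * bareLambda B ^ 2) := by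
    rw [div_pow, hsq]; field_simp; ring
  rw [e8, e98] at hV
  rw [e294] at hJ
  rw [e49] at hT
  exact assembly_ineq ht ht600 hρ₀ hM0 hM (integral_nonneg fun y => sq_nonneg _)
    (flatJumpBall_nonneg ht _ _) (integral_nonneg fun y => mul_nonneg (luscherPotential_nonneg y) (sq_nonneg _))
    (latticeJump_nonneg hBpos.le g)
    (integral_nonneg fun U => mul_nonneg (mul_nonneg hBpos.le (wilsonAction_su2_nonneg U)) (sq_nonneg _)) hJ hV hT hK

/-- **`OneSiteAbsUpperInner k` from the `κ = 7` instance of the flat Kac-form bound** (same statement as `innerOfFlatKac`, weaker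
hypothesis). [cite: Luscher1983, §3] [cite: SimonB1983DiscreteSpectrum, §3] -/
theorem innerOfFlatKacAt (k : ℕ)
    (h7 : ∃ C t₀ : ℝ, 0 < t₀ ∧ ∃ fs : Fin k → ZM → ℝ,
      (∀ i, Continuous (fs i)) ∧ (∀ i, ∃ M : ℝ, ∀ x, |fs i x| ≤ M) ∧ (∀ i, IsGaugeInv (fs i)) ∧ (∀ i, Integrable (fs i)) ∧
      ∀ t : ℝ, 0 < t → t ≤ t₀ → ∀ g : ZM → ℝ, Measurable g → (∃ M : ℝ, ∀ x, |g x| ≤ M) → IsGaugeInv g →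
        (∀ x, g x ≠ 0 → ‖x‖ ≤ 7 / Real.sqrt t) → (∀ i, ∫ x, g x * fs i x = 0) →
        (physLevel (k + 1) - C * t) * ∫ x, g x ^ 2 ≤ kacForm t g) :
    ∃ C₁ B₁ : ℝ, 2 ≤ B₁ ∧ ∀ B, B₁ ≤ B → ∃ φs : Fin k → Cfg → ℝ, (∀ i, IsPhys (φs i)) ∧
      ∀ ψ : Cfg → ℝ, IsPhys ψ → (∀ i, l2 ψ (φs i) = 0) →
      qform su2Rep B (fun U => Real.cos (onePhase (onePhaseScale B) U) * ψ U) (fun U => Real.cos (onePhase (onePhaseScale B) U) * ψ U)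
        ≤ linkCE B * Real.exp (-(physLevel (k + 1) * bareLambda B) + C₁ * bareLambda B ^ 2)
          * l2 (fun U => Real.cos (onePhase (onePhaseScale B) U) * ψ U) (fun U => Real.cos (onePhase (onePhaseScale B) U) * ψ U) :=
  inner_of_jumpEnergyLower k (jumpEnergyLower_of_flatKacAt k h7)

/-- The `κ = 7` instance is indeed what `FlatKacFormBound k` provides. [folklore] -/
theorem flatKacFormBound_at_seven (k : ℕ) (hFlat : FlatKacFormBound k) :
    ∃ C t₀ : ℝ, 0 < t₀ ∧ ∃ fs : Fin k → ZM → ℝ,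
      (∀ i, Continuous (fs i)) ∧ (∀ i, ∃ M : ℝ, ∀ x, |fs i x| ≤ M) ∧ (∀ i, IsGaugeInv (fs i)) ∧ (∀ i, Integrable (fs i)) ∧
      ∀ t : ℝ, 0 < t → t ≤ t₀ → ∀ g : ZM → ℝ, Measurable g → (∃ M : ℝ, ∀ x, |g x| ≤ M) → IsGaugeInv g →
        (∀ x, g x ≠ 0 → ‖x‖ ≤ 7 / Real.sqrt t) → (∀ i, ∫ x, g x * fs i x = 0) →
        (physLevel (k + 1) - C * t) * ∫ x, g x ^ 2 ≤ kacForm t g :=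
  hFlat 7 (by norm_num)

end Summit.QuantumFields.YangMills.Theorems.FemtoTransferGap

end
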